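import Summits.AnomalousDissipation.AnomalousDissipation.Theorems.SolenoidalFractalHomogenisationRealisedQuasiStaticCellLawInPlaneBlock
import HarnessLib

/-!
# K2R `RealisedQuasiStaticCellLaw`, line `floquet-bloch`: the energy of a principal-coset mode splits into its out-of-plane
# and in-plane components (helper towards `stub_lowSectorDecay` / `stub_upperSome`; `--supports stmt-AnomalousDissipation-20446`)

Summits-side helper file (everything proved; no definitions, no named facts). For a real orthonormal pair `(ζ, p)` and a
vector of `ℂ³` lying in their complex span, `‖x‖² = |ζ·x|² + |p·x|²` (`norm_sq_of_frame`); hence, for a Galerkin mode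
`α_N(t)(k_J)` of the cell problem on the coset `k_J = k₀ + J•K_j` (transversal to `k_J ≠ 0`), with `ζ` the unit normal
of `span(k₀, K_j)` and `p_J = |k_J|⁻¹ k_J × ζ`,
`‖α_N(t)(k_J)‖² = ‖⟪ζ, α_N(t)(k_J)⟫‖² + ‖⟪p_J, α_N(t)(k_J)⟫‖²` (`norm_sq_galerkinCoeffAt_eq_blocks`): the coset energy is the
sum of the out-of-plane and in-plane block energies of `…OutOfPlaneDecay` / `…InPlaneDecay`.
-/

set_option linter.dupNamespace false

noncomputable section

namespace Summit.AnomalousDissipation.AnomalousDissipation.Theorems.SolenoidalFractalHomogenisation.RealisedQuasiStaticCellLaw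

open Set MeasureTheory Filter Topology Function Matrix
open scoped InnerProductSpace ComplexConjugate Matrix
open Literature.Analysis Literature.Analysis.FunctionSpaces Literature.Analysis.FunctionSpaces.Torus
open Literature.Analysis.FluidPDE Literature.Analysis.FluidPDE.LatticeShear

variable {k₀ : ℕ}

/-- Inner products of cast real vectors in `ℂ³`: `⟪cast u, cast v⟫ = u·v`. -/
theorem inner_toLp_ofReal_comp_toLp (u v : Fin 3 → ℝ) :
    inner ℂ (WithLp.toLp 2 (Complex.ofReal ∘ u) : EuclideanSpace ℂ (Fin 3))
        (WithLp.toLp 2 (Complex.ofReal ∘ v) : EuclideanSpace ℂ (Fin 3)) = ((u ⬝ᵥ v : ℝ) : ℂ) := by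
  rw [inner_toLp_ofReal_comp, WithLp.ofLp_toLp, ofReal_comp_dotProduct]

/-- The norm of a cast real unit vector is one. -/
theorem norm_toLp_ofReal_comp_eq_one {u : Fin 3 → ℝ} (hu : u ⬝ᵥ u = 1) :
    ‖(WithLp.toLp 2 (Complex.ofReal ∘ u) : EuclideanSpace ℂ (Fin 3))‖ = 1 := by
  have h := inner_toLp_ofReal_comp_toLp u u
  rw [hu] at h
  have h2 : ‖(WithLp.toLp 2 (Complex.ofReal ∘ u) : EuclideanSpace ℂ (Fin 3))‖ ^ 2 = 1 := by
    rw [← inner_self_eq_norm_sq (𝕜 := ℂ), h]; simp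
  have h0 : 0 ≤ ‖(WithLp.toLp 2 (Complex.ofReal ∘ u) : EuclideanSpace ℂ (Fin 3))‖ := norm_nonneg _
  nlinarith

/-- **Pythagoras in a real orthonormal frame of `ℂ³`**: if `(ζ, p)` are real, unit and orthogonal, and
`x = a • ζ + b • p` (`a, b ∈ ℂ`), then `‖x‖² = ‖a‖² + ‖b‖²`. -/
theorem norm_sq_of_frame {ζr pr : Fin 3 → ℝ} (hζ1 : ζr ⬝ᵥ ζr = 1) (hp1 : pr ⬝ᵥ pr = 1) (hζp : ζr ⬝ᵥ pr = 0)
    (a b : ℂ) :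
    ‖(a • (WithLp.toLp 2 (Complex.ofReal ∘ ζr) : EuclideanSpace ℂ (Fin 3)) +
        b • (WithLp.toLp 2 (Complex.ofReal ∘ pr) : EuclideanSpace ℂ (Fin 3)))‖ ^ 2 = ‖a‖ ^ 2 + ‖b‖ ^ 2 := by
  set Z : EuclideanSpace ℂ (Fin 3) := WithLp.toLp 2 (Complex.ofReal ∘ ζr) with hZ
  set P : EuclideanSpace ℂ (Fin 3) := WithLp.toLp 2 (Complex.ofReal ∘ pr) with hP
  have hZP : inner ℂ Z P = 0 := by rw [hZ, hP, inner_toLp_ofReal_comp_toLp, hζp]; simp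
  have horth : inner ℂ (a • Z) (b • P) = 0 := by rw [inner_smul_left, inner_smul_right, hZP]; simp
  have hsq : ‖a • Z + b • P‖ * ‖a • Z + b • P‖ = ‖a • Z‖ * ‖a • Z‖ + ‖b • P‖ * ‖b • P‖ :=
    norm_add_sq_eq_norm_sq_add_norm_sq_of_inner_eq_zero _ _ horth
  rw [sq, hsq, norm_smul, norm_smul, hZ, hP, norm_toLp_ofReal_comp_eq_one hζ1, norm_toLp_ofReal_comp_eq_one hp1]
  ring

/-- The in-plane direction `p = |k|⁻¹ k × ζ` of a non-zero frequency `k ⊥ ζ` (`ζ` unit) is a unit vector. -/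
theorem inPlane_dot_self {k : Fin 3 → ℤ} (hk : k ≠ 0) {ζr : Fin 3 → ℝ} (hζ1 : ζr ⬝ᵥ ζr = 1)
    (hζk : ζr ⬝ᵥ (fun i => ((k i : ℤ) : ℝ)) = 0) :
    ((Real.sqrt ((fun i => ((k i : ℤ) : ℝ)) ⬝ᵥ (fun i => ((k i : ℤ) : ℝ))))⁻¹ • (fun i => ((k i : ℤ) : ℝ)) ⨯₃ ζr) ⬝ᵥ
      ((Real.sqrt ((fun i => ((k i : ℤ) : ℝ)) ⬝ᵥ (fun i => ((k i : ℤ) : ℝ))))⁻¹ • (fun i => ((k i : ℤ) : ℝ)) ⨯₃ ζr) = 1 := by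
  set kr : Fin 3 → ℝ := fun i => ((k i : ℤ) : ℝ) with hkr
  have hkk : 0 < kr ⬝ᵥ kr := by
    obtain ⟨i, hi⟩ : ∃ i, k i ≠ 0 := by
      by_contra h
      push Not at h
      exact hk (funext h)
    have hi' : kr i ≠ 0 := by simp [hkr, hi]
    have : kr ⬝ᵥ kr = ∑ l, kr l ^ 2 := by simp [dotProduct, sq]
    rw [this]
    exact lt_of_lt_of_le (by positivity) (Finset.single_le_sum (fun l _ => sq_nonneg (kr l)) (Finset.mem_univ i))
  have hρsq : Real.sqrt (kr ⬝ᵥ kr) ^ 2 = kr ⬝ᵥ kr := Real.sq_sqrt hkk.le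
  have hρ0 : Real.sqrt (kr ⬝ᵥ kr) ≠ 0 := (Real.sqrt_pos.2 hkk).ne'
  have hkζ : kr ⬝ᵥ ζr = 0 := by rw [dotProduct_comm]; exact hζk
  rw [smul_dotProduct, dotProduct_smul, cross_dot_cross, hζ1, hkζ, smul_eq_mul, smul_eq_mul]
  field_simp
  rw [hρsq]; ring

/-- **Energy split of a transversal vector in the frame of a frequency**: for `k ≠ 0`, a real unit `ζ ⊥ k`,
`p = |k|⁻¹ k × ζ` and `x ∈ ℂ³` with `k·x = 0`: `‖x‖² = ‖⟪ζ, x⟫‖² + ‖⟪p, x⟫‖²`. -/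
theorem norm_sq_eq_blocks_of_transversal {k : Fin 3 → ℤ} (hk : k ≠ 0) {ζr : Fin 3 → ℝ} (hζ1 : ζr ⬝ᵥ ζr = 1)
    (hζk : ζr ⬝ᵥ (fun i => ((k i : ℤ) : ℝ)) = 0) (x : EuclideanSpace ℂ (Fin 3))
    (hx : (fun i => ((k i : ℤ) : ℂ)) ⬝ᵥ WithLp.ofLp x = 0) :
    ‖x‖ ^ 2 =
      ‖inner ℂ (WithLp.toLp 2 (Complex.ofReal ∘ ζr) : EuclideanSpace ℂ (Fin 3)) x‖ ^ 2 +
        ‖inner ℂ (WithLp.toLp 2 (Complex.ofReal ∘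
            ((Real.sqrt ((fun i => ((k i : ℤ) : ℝ)) ⬝ᵥ (fun i => ((k i : ℤ) : ℝ))))⁻¹ •
              (fun i => ((k i : ℤ) : ℝ)) ⨯₃ ζr)) : EuclideanSpace ℂ (Fin 3)) x‖ ^ 2 := by
  set kr : Fin 3 → ℝ := fun i => ((k i : ℤ) : ℝ) with hkr
  set ρ : ℝ := Real.sqrt (kr ⬝ᵥ kr) with hρ
  have hkk : 0 < kr ⬝ᵥ kr := by
    obtain ⟨i, hi⟩ : ∃ i, k i ≠ 0 := by
      by_contra h
      push Not at h
      exact hk (funext h)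
    have hi' : kr i ≠ 0 := by simp [hkr, hi]
    have : kr ⬝ᵥ kr = ∑ l, kr l ^ 2 := by simp [dotProduct, sq]
    rw [this]
    exact lt_of_lt_of_le (by positivity) (Finset.single_le_sum (fun l _ => sq_nonneg (kr l)) (Finset.mem_univ i))
  have hρpos : 0 < ρ := Real.sqrt_pos.2 hkk
  have hρsq : ρ ^ 2 = kr ⬝ᵥ kr := Real.sq_sqrt hkk.le
  set pr : Fin 3 → ℝ := ρ⁻¹ • kr ⨯₃ ζr with hpr
  have hp1 : pr ⬝ᵥ pr = 1 := inPlane_dot_self hk hζ1 hζk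
  have hζp : ζr ⬝ᵥ pr = 0 := by rw [dotProduct_comm, hpr]; exact inPlane_dot_zeta _ _
  -- the complex frame
  set e1 : Fin 3 → ℂ := Complex.ofReal ∘ ζr with he1
  set e3 : Fin 3 → ℂ := Complex.ofReal ∘ (ρ⁻¹ • kr) with he3
  have h11 : e1 ⬝ᵥ e1 = 1 := by rw [he1, ofReal_comp_dotProduct, hζ1]; simp
  have h33 : e3 ⬝ᵥ e3 = 1 := by
    rw [he3, ofReal_comp_dotProduct, smul_dotProduct, dotProduct_smul, smul_eq_mul, smul_eq_mul, ← hρsq]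
    have : ρ⁻¹ * (ρ⁻¹ * ρ ^ 2) = 1 := by field_simp
    rw [this]; simp
  have h31 : e3 ⬝ᵥ e1 = 0 := by
    rw [he3, he1, ofReal_comp_dotProduct, smul_dotProduct, dotProduct_comm, hζk, smul_zero]; simp
  have hx3 : WithLp.ofLp x ⬝ᵥ e3 = 0 := by
    rw [he3, ofReal_comp_smul, dotProduct_smul, dotProduct_comm, hkr, ofReal_comp_intCast, hx, smul_zero]
  have hexp := frame_expansion e1 e3 (WithLp.ofLp x) h11 h33 h31 hx3
  have hp : e3 ⨯₃ e1 = Complex.ofReal ∘ pr := by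
    rw [he3, he1, ofReal_comp_smul, LinearMap.map_smul₂, ofReal_comp_cross, ← ofReal_comp_smul]
  rw [hp] at hexp
  -- transport the expansion to `EuclideanSpace`
  have hxeq : x = (e1 ⬝ᵥ WithLp.ofLp x) • (WithLp.toLp 2 (Complex.ofReal ∘ ζr) : EuclideanSpace ℂ (Fin 3)) +
      ((Complex.ofReal ∘ pr) ⬝ᵥ WithLp.ofLp x) • (WithLp.toLp 2 (Complex.ofReal ∘ pr) : EuclideanSpace ℂ (Fin 3)) := by
    apply (WithLp.ofLp_injective (p := 2))
    rw [WithLp.ofLp_add, WithLp.ofLp_smul, WithLp.ofLp_smul, WithLp.ofLp_toLp, WithLp.ofLp_toLp]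
    exact hexp
  have ha : e1 ⬝ᵥ WithLp.ofLp x = inner ℂ (WithLp.toLp 2 (Complex.ofReal ∘ ζr) : EuclideanSpace ℂ (Fin 3)) x := by
    rw [inner_toLp_ofReal_comp]
  have hb : (Complex.ofReal ∘ pr) ⬝ᵥ WithLp.ofLp x =
      inner ℂ (WithLp.toLp 2 (Complex.ofReal ∘ pr) : EuclideanSpace ℂ (Fin 3)) x := by
    rw [inner_toLp_ofReal_comp]
  conv_lhs => rw [hxeq]
  rw [norm_sq_of_frame hζ1 hp1 hζp, ha, hb]

/-- **The energy of a principal-coset Galerkin mode is the sum of its out-of-plane and in-plane block energies**: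
for `k_J = k₀ + J•K_j ≠ 0`, `ζ` the unit normal of `span(k₀, K_j)` and `p_J = |k_J|⁻¹ k_J × ζ`,
`‖α_N(t)(k_J)‖² = ‖⟪ζ, α_N(t)(k_J)⟫‖² + ‖⟪p_J, α_N(t)(k_J)⟫‖²`. -/
theorem norm_sq_galerkinCoeffAt_eq_blocks (W : LatticeWord k₀) {n : ℕ} (hn : 0 < n) {κ : ℝ} (hκ : 0 ≤ κ)
    (ℓ : Fin 3 → ℤ) {w₀ : UnitAddTorus (Fin 3) → EuclideanSpace ℝ (Fin 3)}
    (hw₀ : FunctionSpaces.Torus.MemSobolev 1 (FunctionSpaces.EuclideanSpace.complexify ∘ w₀))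
    (hdiv : FunctionSpaces.Torus.IsWeaklyDivFree w₀) (hmean : FunctionSpaces.Torus.HasZeroMean w₀)
    (hsupp : ∀ k : Fin 3 → ℤ, ¬ ((∃ z : Fin 3 → ℤ, k = ℓ + (n:ℤ) • z) ∨ (∃ z : Fin 3 → ℤ, k = -ℓ + (n:ℤ) • z)) →
      UnitAddTorus.mFourierCoeff (FunctionSpaces.EuclideanSpace.complexify ∘ w₀) k = 0)
    (N : ℕ) (t : ℝ) (j : Fin k₀) (k0 : Fin 3 → ℤ) (J : ℤ)
    (hkJ : k0 + J • (fun i => (W.phase j).m i * (n : ℤ)) ≠ 0)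
    {ζr : Fin 3 → ℝ} (hζ1 : ζr ⬝ᵥ ζr = 1) (hζ0 : ζr ⬝ᵥ (fun i => ((k0 i : ℤ) : ℝ)) = 0)
    (hζK : ζr ⬝ᵥ (fun i => (((fun i => (W.phase j).m i * (n : ℤ)) i : ℤ) : ℝ)) = 0) :
    ‖(pvSetup_cell W hn hκ ℓ hw₀ hdiv hmean hsupp).galerkinCoeffAt N t (k0 + J • (fun i => (W.phase j).m i * (n : ℤ)))‖ ^ 2 =
      ‖inner ℂ (WithLp.toLp 2 (Complex.ofReal ∘ ζr) : EuclideanSpace ℂ (Fin 3))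
          ((pvSetup_cell W hn hκ ℓ hw₀ hdiv hmean hsupp).galerkinCoeffAt N t
            (k0 + J • (fun i => (W.phase j).m i * (n : ℤ))))‖ ^ 2 +
        ‖inner ℂ (WithLp.toLp 2 (Complex.ofReal ∘
            ((Real.sqrt ((fun i => (((k0 + J • (fun i => (W.phase j).m i * (n : ℤ))) i : ℤ) : ℝ)) ⬝ᵥ
              (fun i => (((k0 + J • (fun i => (W.phase j).m i * (n : ℤ))) i : ℤ) : ℝ))))⁻¹ •
              (fun i => (((k0 + J • (fun i => (W.phase j).m i * (n : ℤ))) i : ℤ) : ℝ)) ⨯₃ ζr)) : EuclideanSpace ℂ (Fin 3))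
          ((pvSetup_cell W hn hκ ℓ hw₀ hdiv hmean hsupp).galerkinCoeffAt N t
            (k0 + J • (fun i => (W.phase j).m i * (n : ℤ))))‖ ^ 2 := by
  refine norm_sq_eq_blocks_of_transversal hkJ hζ1 (zeta_dot_coset hζ0 hζK J) _ ?_
  rw [dotProduct]
  exact (pvSetup_cell W hn hκ ℓ hw₀ hdiv hmean hsupp).sum_mul_galerkinCoeffAt N t _

end Summit.AnomalousDissipation.AnomalousDissipation.Theorems.SolenoidalFractalHomogenisation.RealisedQuasiStaticCellLaw

end
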